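/- Copyright: ym3-torus cell, WIDTH-5 ATTACH seat `ym-ust-19936-w4` (prover, g10), for crux `HistoryTailL` (stmt-QuantumFields-19936),
LINE `local_insertion` (#13, skeleton 48f0ac19), engine E2.  Released under the licence of the surrounding project. -/
import Summits.QuantumFields.YangMills.Theorems.LocalInsertionChessboardInsertionBound
import Summits.QuantumFields.YangMills.Theorems.UnitScaleTiltHistoryTailChessboardT3
import HarnessLib

/-!
# LINE `local_insertion`, engine E2, file B: the chessboard bound for one bounded insertion — 3-d letters and the LINE-13 reading

Support file (`--supports stmt-QuantumFields-19936 --as helper`) for LINE #13 `local_insertion` of crux `HistoryTailL` (route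
`LocalInsertion`).  File A (`…ChessboardInsertionBound`) proves, for a general `P : Params`, the multiple-reflection bound for ONE
bounded nonnegative insertion `g(dist1 Ū^K(∂p))` of the averaged plaquette variable under the `SU(n)` Wilson–Gibbs state, with a
separated mirror family through any plaquette.  Here:

§1 **`chessboardInsertion_T3`** — the 3-d `T3Family` letters, the FUNCTION twin of ✓`HistoryTailChessboardT3.chessboardRP_T3`
(same quantifier block, same separation `ρ` and cell count): for every cut-off `K`, height `j ≤ K`, `ρ ≥ 1`, measurable `g` with
`0 ≤ g ≤ B` and level-`j` plaquette `p` there is a finite family `S ∋ p` of level-`j` plaquettes, pairwise `ρ`-separated,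
numerous (`sitesPerDir(j)³ ≤ |S|·8(L(ρ+4))³`), with
`∫ g(dist1 Ū^j(∂p)) ∂Gibbs_K ≤ (∫ ∏_{q∈S} g(dist1 Ū^j(∂q)) ∂Gibbs_K)^{1∕|S|}`.

§2 **`setIntegral_insertion_le_rpow_periodised_T3`** — the LINE-13 reading at the insertion of BOTH registered stubs
(`stub_insertionHeightOne`, `stub_insertionHigher`) and of the route crux `LocalInsertionL`: with
`g := exp(ε·min(x ∕ g_{K−j}, p(g_{K−j})))`, `g_{K−j} = √(γL^{−(K−j)})`, `p = B10.pFun b₀ p₀`, for EVERY `ε ≥ 0` and EVERY event `G`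
(in particular the stubs' local small-history event `G(a,j)`):
`∫_{G} exp(ε·min(dist1 Ū^j(∂a)∕g_{K−j}, p)) ∂Gibbs_K ≤ (∫ exp(ε·Σ_{q∈S} min(dist1 Ū^j(∂q)∕g_{K−j}, p)) ∂Gibbs_K)^{1∕|S|}`
— the card's E2 sentence «the chessboard estimate bounds `E e^{εφ_a}` by exp(pressure shift of the reflection-periodised
insertion)» BY KERNEL: the right-hand side is `exp(|S|⁻¹·log Z_K(ε·Σ_{q∈S} φ_q)∕Z_K(0))`, one bounded (`≤ ε·p(g_{K−j})`)
gauge-invariant capped insertion per cell of side `L^s` (`s` least with `ρ + 4 < L^s`) at height `j`.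

§3 **`localInsertion_of_diluteInsertionBound`** (parametric height range) and its two instances
**`insertionHeightOne_of_diluteInsertionBound`**, **`insertionHigher_of_diluteInsertionBound`** — the E2 ADAPTER: the TEXTS of
both registered stubs follow, with the same `(ε₀, M₀, γ₁)`, from a `K`-uniform DILUTE-FAMILY insertion bound
`E_K[exp(ε·Σ_{q∈S} φ_q)] ≤ M₀^{|S|}` for pairwise `ρ`-separated finite families `S` of level-`j` plaquettes (some `ρ ≥ 1`), displayed
as the hypothesis — so, BY KERNEL, engine E2 reduces LINE #13's stubs to the UV stability of a dilute gas of capped insertions.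
§4 **`integral_exp_sum_eq_dressedZ_div`** — the pressure form: that moment is the ratio `Z_K(ε; Σ_{q∈S} φ_q) ∕ Z_K(0)` of the T⁴
cell's dressed partition functions (`T4GenFunBounds.dressedZ`), so the hypothesis is a one-sided King-(2.23)-type UV-stability bound
`log Z_K(ε; Σ_{q∈S} φ_q) − log Z_K(0) ≤ |S|·log M₀`, linear in the number of insertions.

HONEST SCOPE.  Soft finite-torus reflection-positivity bookkeeping over tree theorems; no estimate of Bałaban's papers is used or
asserted; E2's remaining content — a `K`-uniform bound `|S|⁻¹·log E_K[exp(ε·Σ_{q∈S} φ_q)] ≤ log M₀`, i.e. UV stability of the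
reflection-periodised capped insertion (the card's «Cor. 3 with shifted E±») — is NOT touched; nothing of the stubs, of
`LocalInsertionL` (23607), of the glue (23608), of `HistoryTailL` or of any crux is proved.  YM₃ on T³ is rung R3 of the ladder — not
d = 4, not infinite volume, not a mass gap, not Clay.
-/

namespace Summit.QuantumFields.YangMills.Theorems.LocalInsertion.ChessboardInsertionT3

open MeasureTheory Finset
open Literature.Barriers.CriticalPhenomena.NonGibbs
open Literature.MathematicalPhysics.QuantumFieldTheory
open Literature.MathematicalPhysics.QuantumFieldTheory.Balaban1983to89
open Literature.MathematicalPhysics.QuantumFieldTheory.Balaban1983to89.T3ContinuumYM3Torus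
open Literature.MathematicalPhysics.QuantumFieldTheory.Balaban1983to89.T3UnitScaleTilt
open Literature.MathematicalPhysics.QuantumFieldTheory.Balaban1983to89.T3UnitLawDensityEML
open Summit.QuantumFields.YangMills.Theorems.HistoryTailChessboardT3 (sitesPerDir_eq card_blockIdx)
open Summit.QuantumFields.YangMills.Theorems.LocalInsertion.ChessboardInsertion

noncomputable section

/-! ## §1 The 3-d letters: a separated, numerous family with the insertion bound, at every height -/

/-- **THE CHESSBOARD ESTIMATE FOR ONE BOUNDED INSERTION OF AN AVERAGED-PLAQUETTE VARIABLE, 3-d letters** — the function twin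
of ✓`chessboardRP_T3` (file A's `exists_separated_mirror_family_integral` on the 3-d family, cells of side `L^s`, `s` least
with `ρ + 4 < L^s`; when the cells exceed the torus, `S := {p}`). [folklore] -/
theorem chessboardInsertion_T3 :
    ∀ (L : ℕ), Odd L → 1 < L →
      ∀ (F : T3Family) (γ : ℝ), F.L = L → 0 < γ → γ ≤ 1 → ∀ (K j : ℕ), j ≤ K → ∀ (ρ : ℝ), 1 ≤ ρ →
        ∀ (g : ℝ → ℝ), Measurable g → (∀ x, 0 ≤ g x) → ∀ (B : ℝ), (∀ x, g x ≤ B) →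
        ∀ p : Plaq (F.P K) j,
          ∃ S : Finset (Plaq (F.P K) j), p ∈ S ∧
            (∀ q ∈ S, ∀ q' ∈ S, q ≠ q' → ρ ≤ (Site.tdist q.src q'.src : ℝ)) ∧
            (((F.P K).sitesPerDir j : ℝ) ^ 3 ≤ (S.card : ℝ) * (8 * ((F.L : ℝ) * (ρ + 4)) ^ 3)) ∧
            ∫ U, g (GaugeGroup.dist1 (GaugeField.plaqHol
                (Averaging.iter (fun _ => BlockAveraging.blockAvg ℰp) j U) p)) ∂(gibbsK F ℰp γ K) ≤
              (∫ U, ∏ q ∈ S, g (GaugeGroup.dist1 (GaugeField.plaqHol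
                (Averaging.iter (fun _ => BlockAveraging.blockAvg ℰp) j U) q)) ∂(gibbsK F ℰp γ K)) ^
                ((1 : ℝ) / (S.card : ℝ)) := by
  intro L _hLodd hL1 F γ hFL hγ _hγ1 K j hjK ρ hρ g hgm hg0 B hgB p
  classical
  subst hFL
  -- the cell exponent: the least `s` with `ρ + 4 < L^s`
  have hL1R : (1 : ℝ) < (F.L : ℝ) := by exact_mod_cast hL1
  have hex : ∃ s : ℕ, ρ + 4 < (F.L : ℝ) ^ s := pow_unbounded_of_one_lt (ρ + 4) hL1R
  set s := Nat.find hex with hs_def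
  have hs : ρ + 4 < (F.L : ℝ) ^ s := Nat.find_spec hex
  have hs1 : 1 ≤ s := by
    by_contra h0
    have h0' : s = 0 := by omega
    rw [h0', pow_zero] at hs
    linarith
  have hmin : (F.L : ℝ) ^ (s - 1) ≤ ρ + 4 := by
    have := Nat.find_min hex (show s - 1 < Nat.find hex by omega)
    exact not_lt.1 this
  have hLpos : (0 : ℝ) < F.L := by linarith
  -- `L^s ≤ L (ρ + 4)`
  have hMle : ((F.L ^ s : ℕ) : ℝ) ≤ (F.L : ℝ) * (ρ + 4) := by
    have e : ((F.L ^ s : ℕ) : ℝ) = (F.L : ℝ) * (F.L : ℝ) ^ (s - 1) := by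
      rw [Nat.cast_pow, ← pow_succ', Nat.sub_add_cancel hs1]
    rw [e]
    exact mul_le_mul_of_nonneg_left hmin hLpos.le
  have hβ : 0 ≤ (F.scheme ℰp γ).β K := F.scheme_β_nonneg ℰp hγ.le K
  by_cases hfit : s ≤ F.m + K - j
  · -- the cells fit in the torus: `M := L^s`, `N := 2·L^{m+K−j−s}`
    set t : ℕ := F.m + K - j - s with ht_def
    set M : ℕ := F.L ^ s with hM_def
    set N : ℕ := 2 * F.L ^ t with hN_def
    haveI : NeZero N := ⟨by rw [hN_def]; positivity⟩
    have hN : Even N := ⟨F.L ^ t, by rw [hN_def]; ring⟩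
    have hst : F.m + K - j = s + t := by omega
    have h : (F.P K).sitesPerDir j = M * N := by
      rw [sitesPerDir_eq, hst, pow_add, hM_def, hN_def]
      ring
    have hM2 : 2 ≤ M := by
      rw [hM_def]
      calc 2 ≤ F.L := hL1
        _ = F.L ^ 1 := (pow_one _).symm
        _ ≤ F.L ^ s := Nat.pow_le_pow_right (by omega) hs1
    have hK : j ≤ (F.P K).m + (F.P K).K := by show j ≤ F.m + K; omega
    obtain ⟨q, hinj, ⟨c₀, hc₀⟩, -, hsep, hbound⟩ :=
      exists_separated_mirror_family_integral (F.P K) hβ (fun _ => ℰp) (fun _ l => measurableE_ℰp l) j hK h hN hM2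
        hgm hg0 hgB p
    refine ⟨univ.image q, mem_image.2 ⟨c₀, mem_univ _, hc₀⟩, ?_, ?_, ?_⟩
    · -- pairwise separation
      intro q₁ hq₁ q₂ hq₂ hne
      obtain ⟨c₁, -, rfl⟩ := mem_image.1 hq₁
      obtain ⟨c₂, -, rfl⟩ := mem_image.1 hq₂
      have hc : c₁ ≠ c₂ := fun e => hne (by rw [e])
      have h1 := hsep c₁ c₂ hc
      have hMR : ρ ≤ ((M - 1 : ℕ) : ℝ) := by
        rw [Nat.cast_sub (by omega : 1 ≤ M), Nat.cast_one, hM_def, Nat.cast_pow]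
        linarith
      exact hMR.trans (by exact_mod_cast h1)
    · -- the count
      have hcard : (univ.image q).card = N ^ 3 := by
        rw [card_image_of_injective _ hinj, card_univ, card_blockIdx]
      rw [hcard, h]
      push_cast
      have hM0 : (0 : ℝ) ≤ (M : ℝ) := Nat.cast_nonneg _
      have hM' : (M : ℝ) ≤ 2 * ((F.L : ℝ) * (ρ + 4)) := by
        have : (M : ℝ) ≤ (F.L : ℝ) * (ρ + 4) := by rw [hM_def]; exact hMle
        nlinarith
      have hN0 : (0 : ℝ) ≤ (N : ℝ) ^ 3 := by positivity
      calc ((M : ℝ) * N) ^ 3 = (N : ℝ) ^ 3 * (M : ℝ) ^ 3 := by ring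
        _ ≤ (N : ℝ) ^ 3 * (2 * ((F.L : ℝ) * (ρ + 4))) ^ 3 :=
            mul_le_mul_of_nonneg_left (pow_le_pow_left₀ hM0 hM' 3) hN0
        _ = (N : ℝ) ^ 3 * (8 * ((F.L : ℝ) * (ρ + 4)) ^ 3) := by ring
    · -- the estimate
      have hcard : ((univ.image q).card : ℝ) = (N : ℝ) ^ (F.P K).d := by
        rw [card_image_of_injective _ hinj, card_univ, card_blockIdx]
        push_cast
        rfl
      have eS : ∀ U : GaugeField (F.P K) 0 (Matrix.specialUnitaryGroup (Fin 2) ℂ),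
          ∏ q' ∈ univ.image q, g (GaugeGroup.dist1 (GaugeField.plaqHol
            (Averaging.iter (fun _ => BlockAveraging.blockAvg ℰp) j U) q')) =
          ∏ c : BlockIdx (F.P K).d N, g (GaugeGroup.dist1 (GaugeField.plaqHol
            (Averaging.iter (fun k => BlockAveraging.blockAvg (P := F.P K) (j := k) ((fun _ => ℰp) k)) j U) (q c))) :=
        fun U => prod_image fun c₁ _ c₂ _ e => hinj e
      rw [hcard, gibbsK_eq]
      simp_rw [eS]
      exact hbound
  · -- the cells exceed the torus: `S := {p}`
    refine ⟨{p}, mem_singleton_self p, ?_, ?_, ?_⟩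
    · intro q hq q' hq' hne
      rw [mem_singleton] at hq hq'
      exact absurd (hq.trans hq'.symm) hne
    · rw [card_singleton, Nat.cast_one, one_mul, sitesPerDir_eq]
      push_cast
      have hle : (F.L : ℝ) ^ (F.m + K - j) ≤ ρ + 4 := by
        calc (F.L : ℝ) ^ (F.m + K - j) ≤ (F.L : ℝ) ^ (s - 1) := pow_le_pow_right₀ hL1R.le (by omega)
          _ ≤ ρ + 4 := hmin
      have h0 : (0 : ℝ) ≤ 2 * (F.L : ℝ) ^ (F.m + K - j) := by positivity
      have h1 : 2 * (F.L : ℝ) ^ (F.m + K - j) ≤ 2 * ((F.L : ℝ) * (ρ + 4)) := by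
        have : ρ + 4 ≤ (F.L : ℝ) * (ρ + 4) := by nlinarith
        linarith
      calc (2 * (F.L : ℝ) ^ (F.m + K - j)) ^ 3 ≤ (2 * ((F.L : ℝ) * (ρ + 4))) ^ 3 := pow_le_pow_left₀ h0 h1 3
        _ = 8 * ((F.L : ℝ) * (ρ + 4)) ^ 3 := by ring
    · rw [card_singleton, Nat.cast_one, div_one, Real.rpow_one]
      simp only [prod_singleton]
      exact le_rfl

/-! ## §2 The LINE-13 reading: the capped exponential insertion of both registered stubs -/

/-- the LINE-13 insertion profile `x ↦ exp(ε·min(x∕g, p))` is measurable, nonnegative and, for `ε ≥ 0`, bounded by `exp(ε·p)`.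
[folklore] -/
theorem insertionProfile_measurable_nonneg_le (ε gK pK : ℝ) (hε : 0 ≤ ε) :
    Measurable (fun x : ℝ => Real.exp (ε * min (x / gK) pK)) ∧
      (∀ x : ℝ, 0 ≤ Real.exp (ε * min (x / gK) pK)) ∧
      (∀ x : ℝ, Real.exp (ε * min (x / gK) pK) ≤ Real.exp (ε * pK)) := by
  refine ⟨?_, fun x => (Real.exp_pos _).le, fun x => ?_⟩
  · exact (measurable_const.mul ((measurable_id.div_const gK).min measurable_const)).exp
  · exact Real.exp_le_exp.2 (mul_le_mul_of_nonneg_left (min_le_right _ _) hε)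

/-- **THE LINE-13 READING: THE CAPPED EXPONENTIAL INSERTION IS BOUNDED BY THE `|S|`-TH ROOT OF THE PARTITION-FUNCTION RATIO OF
ITS REFLECTION-PERIODISATION.**  For every `L` (odd, `> 1`), `T3Family F` with `F.L = L`, `0 < γ ≤ 1`, EVERY `ε ≥ 0`, every
profile `(b₀, p₀)`, every cut-off `K`, height `j ≤ K`, separation `ρ ≥ 1`, level-`j` plaquette `a` and EVERY event `G` (for the
stubs: the local small-history event `G(a,j)`), there is a finite family `S ∋ a` of level-`j` plaquettes, pairwise `ρ`-separated,
numerous, with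
`∫_{G} exp(ε·min(dist1 Ū^j(∂a)∕g_{K−j}, p(g_{K−j}))) ∂Gibbs_K ≤ (∫ exp(ε·Σ_{q∈S} min(dist1 Ū^j(∂q)∕g_{K−j}, p(g_{K−j}))) ∂Gibbs_K)^{1∕|S|}`,
`g_{K−j} = √(γ·L^{−(K−j)})`, `p = B10.pFun b₀ p₀` — the insertion and its letters being those of `stub_insertionHeightOne ∕
stub_insertionHigher ∕ LocalInsertionL` verbatim (the event is dropped on the left by positivity, §1 at the profile of
`insertionProfile_measurable_nonneg_le`, `exp Σ = ∏ exp`). [folklore] -/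
theorem setIntegral_insertion_le_rpow_periodised_T3 :
    ∀ (L : ℕ), Odd L → 1 < L →
      ∀ (F : T3Family) (γ : ℝ), F.L = L → 0 < γ → γ ≤ 1 → ∀ (ε : ℝ), 0 ≤ ε → ∀ (b₀ p₀ : ℝ) (K j : ℕ), j ≤ K →
        ∀ (ρ : ℝ), 1 ≤ ρ → ∀ (a : Plaq (F.P K) j) (G : Set (GaugeField (F.P K) 0 (Matrix.specialUnitaryGroup (Fin 2) ℂ))),
          ∃ S : Finset (Plaq (F.P K) j), a ∈ S ∧
            (∀ q ∈ S, ∀ q' ∈ S, q ≠ q' → ρ ≤ (Site.tdist q.src q'.src : ℝ)) ∧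
            (((F.P K).sitesPerDir j : ℝ) ^ 3 ≤ (S.card : ℝ) * (8 * ((F.L : ℝ) * (ρ + 4)) ^ 3)) ∧
            ∫ U in G, Real.exp (ε * min (GaugeGroup.dist1 (GaugeField.plaqHol (Averaging.iter
                (fun i' => BlockAveraging.blockAvg (P := F.P K) (j := i') T3UnitLawDensityEML.ℰp) j U) a) /
                  Real.sqrt (γ * ((F.L : ℝ)⁻¹) ^ (K - j)))
                (B10.pFun b₀ p₀ (Real.sqrt (γ * ((F.L : ℝ)⁻¹) ^ (K - j)))))
              ∂(T3UnitScaleTilt.gibbsK F T3UnitLawDensityEML.ℰp γ K) ≤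
            (∫ U, Real.exp (ε * ∑ q ∈ S, min (GaugeGroup.dist1 (GaugeField.plaqHol (Averaging.iter
                (fun i' => BlockAveraging.blockAvg (P := F.P K) (j := i') T3UnitLawDensityEML.ℰp) j U) q) /
                  Real.sqrt (γ * ((F.L : ℝ)⁻¹) ^ (K - j)))
                (B10.pFun b₀ p₀ (Real.sqrt (γ * ((F.L : ℝ)⁻¹) ^ (K - j)))))
              ∂(T3UnitScaleTilt.gibbsK F T3UnitLawDensityEML.ℰp γ K)) ^ ((1 : ℝ) / (S.card : ℝ)) := by
  intro L hLodd hL1 F γ hFL hγ hγ1 ε hε b₀ p₀ K j hjK ρ hρ a G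
  classical
  set gK : ℝ := Real.sqrt (γ * ((F.L : ℝ)⁻¹) ^ (K - j)) with hgK_def
  set pK : ℝ := B10.pFun b₀ p₀ gK with hpK_def
  obtain ⟨hgm, hg0, hgB⟩ := insertionProfile_measurable_nonneg_le ε gK pK hε
  obtain ⟨S, haS, hsep, hcount, hbound⟩ :=
    chessboardInsertion_T3 L hLodd hL1 F γ hFL hγ hγ1 K j hjK ρ hρ _ hgm hg0 _ hgB a
  refine ⟨S, haS, hsep, hcount, ?_⟩
  haveI := isProbabilityMeasure_gibbsK F ℰp hγ.le K
  -- measurability of the averaged plaquette variable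
  have hA : ∀ k, Measurable (BlockAveraging.blockAvg (P := F.P K) (j := k) ℰp).avg := fun k =>
    BlockAveraging.measurable_avgFun ℰp measurableE_ℰp
  have hX : ∀ q : Plaq (F.P K) j, Measurable fun U : GaugeField (F.P K) 0 (Matrix.specialUnitaryGroup (Fin 2) ℂ) =>
      GaugeGroup.dist1 (GaugeField.plaqHol (Averaging.iter
        (fun i' => BlockAveraging.blockAvg (P := F.P K) (j := i') ℰp) j U) q) := fun q =>
    RegularGaugeGroup.measurable_dist1.comp ((Missing.measurable_plaqHol _).comp (T4Continuum.measurable_iter _ hA j))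
  -- drop the event on the left
  have hint : Integrable (fun U : GaugeField (F.P K) 0 (Matrix.specialUnitaryGroup (Fin 2) ℂ) =>
      Real.exp (ε * min (GaugeGroup.dist1 (GaugeField.plaqHol (Averaging.iter
        (fun i' => BlockAveraging.blockAvg (P := F.P K) (j := i') ℰp) j U) a) / gK) pK)) (gibbsK F ℰp γ K) :=
    Integrable.of_bound (hgm.comp (hX a)).aestronglyMeasurable (Real.exp (ε * pK))
      (ae_of_all _ fun U => by rw [Real.norm_eq_abs, abs_of_nonneg (hg0 _)]; exact hgB _)
  have hdrop := setIntegral_le_integral (s := G) hint (ae_of_all _ fun U => hg0 _)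
  refine hdrop.trans ?_
  -- `∏ exp = exp Σ`
  have eprod : ∀ U : GaugeField (F.P K) 0 (Matrix.specialUnitaryGroup (Fin 2) ℂ),
      ∏ q ∈ S, Real.exp (ε * min (GaugeGroup.dist1 (GaugeField.plaqHol (Averaging.iter
        (fun _ => BlockAveraging.blockAvg ℰp) j U) q) / gK) pK) =
      Real.exp (ε * ∑ q ∈ S, min (GaugeGroup.dist1 (GaugeField.plaqHol (Averaging.iter
        (fun i' => BlockAveraging.blockAvg (P := F.P K) (j := i') ℰp) j U) q) / gK) pK) := by
    intro U
    rw [mul_sum, Real.exp_sum]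
  simp_rw [eprod] at hbound
  exact hbound

/-! ## §3 The E2 adapter: both registered stub texts from a dilute-family insertion bound -/

/-- **THE E2 ADAPTER (parametric height range `R`)**: a `K`-uniform DILUTE-FAMILY bound for the capped exponential insertion —
for some separation `ρ ≥ 1`, `E_K[exp(ε·Σ_{q∈S} φ_q)] ≤ M₀^{|S|}` for every pairwise `ρ`-separated finite family `S` of level-`j`
plaquettes (the UV stability of a dilute gas of bounded gauge-invariant capped insertions at height `j`: engine E2's organ content,
DISPLAYED as the hypothesis, not asserted) — gives the LINE-13 local exponential moment `∫_{G(a,j)} exp(ε·φ_a) ∂Gibbs_K ≤ M₀` with the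
SAME `(ε₀, M₀, γ₁)`, on the same height range `R` (§2 + `(M₀^{|S|})^{1∕|S|} = M₀`). [folklore] -/
theorem localInsertion_of_diluteInsertionBound (R : ℕ → ℕ → Prop)
    (hE2 : open Literature.MathematicalPhysics.QuantumFieldTheory.Balaban1983to89 Literature.MathematicalPhysics.QuantumFieldTheory.Balaban1983to89.T3ContinuumYM3Torus in ∀ (L : ℕ), ∃ ε₀ : ℝ, 0 < ε₀ ∧ ∀ (ε : ℝ), 0 < ε → ε ≤ ε₀ → ∀ (b₀ p₀ : ℝ), 0 < b₀ → 2 < p₀ → ∃ M₀ : ℝ, 0 ≤ M₀ ∧ ∃ γ₁ : ℝ, 0 < γ₁ ∧ γ₁ ≤ 1 ∧ ∀ (F : T3Family) (γ : ℝ), F.L = L → 0 < γ → γ ≤ γ₁ → ∀ (K j : ℕ), 1 ≤ j → j ≤ K → R K j → ∃ ρ : ℝ, 1 ≤ ρ ∧ ∀ (S : Finset (Plaq (F.P K) j)), (∀ q ∈ S, ∀ q' ∈ S, q ≠ q' → ρ ≤ (Site.tdist q.src q'.src : ℝ)) → ∫ U, Real.exp (ε * ∑ q ∈ S, min (GaugeGroup.dist1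 (GaugeField.plaqHol (Averaging.iter (fun i' => BlockAveraging.blockAvg (P := F.P K) (j := i') T3UnitLawDensityEML.ℰp) j U) q) / Real.sqrt (γ * ((F.L : ℝ)⁻¹) ^ (K - j))) (B10.pFun b₀ p₀ (Real.sqrt (γ * ((F.L : ℝ)⁻¹) ^ (K - j))))) ∂(T3UnitScaleTilt.gibbsK F T3UnitLawDensityEML.ℰp γ K) ≤ M₀ ^ S.card) :
    open Literature.MathematicalPhysics.QuantumFieldTheory.Balaban1983to89 Literature.MathematicalPhysics.QuantumFieldTheory.Balaban1983to89.T3ContinuumYM3Torus in ∀ (L : ℕ), ∃ ε₀ : ℝ, 0 < ε₀ ∧ ∀ (ε : ℝ), 0 < ε → ε ≤ ε₀ → ∀ (b₀ p₀ : ℝ), 0 < b₀ → 2 < p₀ → ∃ M₀ : ℝ, 0 ≤ M₀ ∧ ∃ γ₁ : ℝ, 0 < γ₁ ∧ γ₁ ≤ 1 ∧ ∀ (F : T3Family) (γ : ℝ), F.L = L → 0 < γ → γ ≤ γ₁ → ∀ (K j : ℕ), 1 ≤ j → j ≤ K → R K j → ∀ (a : Plaq (F.P K) j), ∫ U in {U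 | (∀ (i : ℕ) (q : Plaq (F.P K) i), i < j → Site.tdist (fun k => ((((q.src k).val * F.L ^ i : ℕ)) : ZMod ((F.P K).sitesPerDir 0))) (fun k => ((((a.src k).val * F.L ^ j : ℕ)) : ZMod ((F.P K).sitesPerDir 0))) + 64 * F.L ^ i ≤ 64 * F.L ^ j → GaugeGroup.dist1 (GaugeField.plaqHol (Averaging.iter (fun i' => BlockAveraging.blockAvg (P := F.P K) (j := i') T3UnitLawDensityEML.ℰp) i U) q) < T3UnitScaleTilt.θBal F.L γ b₀ p₀ (K - i))}, Real.exp (ε * min (GaugeGroup.dist1 (GaugeField.plaqHol (Averaging.iter (fun i' => BlockAveraging.blockAvg (P := F.P K) (j := i') T3UnitLawDensityEML.ℰp) j U) a) / Real.sqrt (γ * ((F.L : ℝ)⁻¹) ^ (K - j))) (B10.pFun b₀ p₀ (Real.sqrt (γ * ((F.L : ℝ)⁻¹) ^ (K - j))))) ∂(T3UnitScaleTilt.gibbsK F T3UnitLawDensityEML.ℰp γ K) ≤ M₀ := by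
  intro L
  obtain ⟨ε₀, hε₀, H⟩ := hE2 L
  refine ⟨ε₀, hε₀, fun ε hε hεle b₀ p₀ hb₀ hp₀ => ?_⟩
  obtain ⟨M₀, hM₀, γ₁, hγ₁, hγ₁1, H1⟩ := H ε hε hεle b₀ p₀ hb₀ hp₀
  refine ⟨M₀, hM₀, γ₁, hγ₁, hγ₁1, fun F γ hFL hγ hγle K j hj hjK hRKj a => ?_⟩
  obtain ⟨ρ, hρ, HS⟩ := H1 F γ hFL hγ hγle K j hj hjK hRKj
  have hL : Odd L ∧ 1 < L := hFL ▸ F.hL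
  obtain ⟨S, haS, hsep, -, hbound⟩ := setIntegral_insertion_le_rpow_periodised_T3 L hL.1 hL.2 F γ hFL hγ
    (hγle.trans hγ₁1) ε hε.le b₀ p₀ K j hjK ρ hρ a _
  refine hbound.trans ?_
  have hcard : S.card ≠ 0 := card_ne_zero.2 ⟨a, haS⟩
  have hI0 : 0 ≤ ∫ U, Real.exp (ε * ∑ q ∈ S, min (GaugeGroup.dist1 (GaugeField.plaqHol (Averaging.iter (fun i' => BlockAveraging.blockAvg (P := F.P K) (j := i') T3UnitLawDensityEML.ℰp) j U) q) / Real.sqrt (γ * ((F.L : ℝ)⁻¹) ^ (K - j))) (B10.pFun b₀ p₀ (Real.sqrt (γ * ((F.L : ℝ)⁻¹) ^ (K - j))))) ∂(T3UnitScaleTilt.gibbsK F T3UnitLawDensityEML.ℰp γ K) :=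
    integral_nonneg fun U => (Real.exp_pos _).le
  calc (∫ U, Real.exp (ε * ∑ q ∈ S, min (GaugeGroup.dist1 (GaugeField.plaqHol (Averaging.iter (fun i' => BlockAveraging.blockAvg (P := F.P K) (j := i') T3UnitLawDensityEML.ℰp) j U) q) / Real.sqrt (γ * ((F.L : ℝ)⁻¹) ^ (K - j))) (B10.pFun b₀ p₀ (Real.sqrt (γ * ((F.L : ℝ)⁻¹) ^ (K - j))))) ∂(T3UnitScaleTilt.gibbsK F T3UnitLawDensityEML.ℰp γ K)) ^ ((1 : ℝ) / (S.card : ℝ))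
      ≤ (M₀ ^ S.card) ^ ((1 : ℝ) / (S.card : ℝ)) :=
        Real.rpow_le_rpow hI0 (HS S hsep) (by positivity)
    _ = M₀ := by rw [one_div, Real.pow_rpow_inv_natCast hM₀ hcard]

/-- **`stub_insertionHeightOne`'s TEXT from the dilute-family insertion bound at height `j ≤ 1`** (the registered stub of LINE #13,
verbatim as the conclusion; E2's organ content displayed as the hypothesis). [folklore] -/
theorem insertionHeightOne_of_diluteInsertionBound
    (hE2 : open Literature.MathematicalPhysics.QuantumFieldTheory.Balaban1983to89 Literature.MathematicalPhysics.QuantumFieldTheory.Balaban1983to89.T3ContinuumYM3Torus in ∀ (L : ℕ), ∃ ε₀ : ℝ, 0 < ε₀ ∧ ∀ (ε : ℝ), 0 < ε → ε ≤ ε₀ → ∀ (b₀ p₀ : ℝ), 0 < b₀ → 2 < p₀ → ∃ M₀ : ℝ, 0 ≤ M₀ ∧ ∃ γ₁ : ℝ, 0 < γ₁ ∧ γ₁ ≤ 1 ∧ ∀ (F : T3Family) (γ : ℝ), F.L = L → 0 < γ → γ ≤ γ₁ → ∀ (K j : ℕ), 1 ≤ j → j ≤ K → j ≤ 1 → ∃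 ρ : ℝ, 1 ≤ ρ ∧ ∀ (S : Finset (Plaq (F.P K) j)), (∀ q ∈ S, ∀ q' ∈ S, q ≠ q' → ρ ≤ (Site.tdist q.src q'.src : ℝ)) → ∫ U, Real.exp (ε * ∑ q ∈ S, min (GaugeGroup.dist1 (GaugeField.plaqHol (Averaging.iter (fun i' => BlockAveraging.blockAvg (P := F.P K) (j := i') T3UnitLawDensityEML.ℰp) j U) q) / Real.sqrt (γ * ((F.L : ℝ)⁻¹) ^ (K - j))) (B10.pFun b₀ p₀ (Real.sqrt (γ * ((F.L : ℝ)⁻¹) ^ (K - j))))) ∂(T3UnitScaleTilt.gibbsK F T3UnitLawDensityEML.ℰp γ K) ≤ M₀ ^ S.card) :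
    open Literature.MathematicalPhysics.QuantumFieldTheory.Balaban1983to89 Literature.MathematicalPhysics.QuantumFieldTheory.Balaban1983to89.T3ContinuumYM3Torus in ∀ (L : ℕ), ∃ ε₀ : ℝ, 0 < ε₀ ∧ ∀ (ε : ℝ), 0 < ε → ε ≤ ε₀ → ∀ (b₀ p₀ : ℝ), 0 < b₀ → 2 < p₀ → ∃ M₀ : ℝ, 0 ≤ M₀ ∧ ∃ γ₁ : ℝ, 0 < γ₁ ∧ γ₁ ≤ 1 ∧ ∀ (F : T3Family) (γ : ℝ), F.L = L → 0 < γ → γ ≤ γ₁ → ∀ (K j : ℕ), 1 ≤ j → j ≤ K → j ≤ 1 → ∀ (a : Plaq (F.P K) j), ∫ U in {U | (∀ (i : ℕ) (q : Plaq (F.P K) i), i < j → Site.tdist (fun k => ((((q.src k).val * F.L ^ i : ℕ)) : ZMod ((F.P K).sitesPerDir 0))) (fun k => ((((a.src k).val * F.L ^ j : ℕ)) : ZMod ((F.P K).sitesPerDir 0))) + 64 * F.L ^ i ≤ 64 * F.L ^ j → GaugeGroup.dist1 (GaugeField.plaqHol (Averaging.iter (fun i' => BlockAveraging.blockAvg (P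 := F.P K) (j := i') T3UnitLawDensityEML.ℰp) i U) q) < T3UnitScaleTilt.θBal F.L γ b₀ p₀ (K - i))}, Real.exp (ε * min (GaugeGroup.dist1 (GaugeField.plaqHol (Averaging.iter (fun i' => BlockAveraging.blockAvg (P := F.P K) (j := i') T3UnitLawDensityEML.ℰp) j U) a) / Real.sqrt (γ * ((F.L : ℝ)⁻¹) ^ (K - j))) (B10.pFun b₀ p₀ (Real.sqrt (γ * ((F.L : ℝ)⁻¹) ^ (K - j))))) ∂(T3UnitScaleTilt.gibbsK F T3UnitLawDensityEML.ℰp γ K) ≤ M₀ :=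
  localInsertion_of_diluteInsertionBound (fun _ j => j ≤ 1) hE2

/-- **`stub_insertionHigher`'s TEXT from the dilute-family insertion bound at heights `2 ≤ j`** (the registered HARDEST stub of
LINE #13, verbatim as the conclusion; E2's organ content displayed as the hypothesis). [folklore] -/
theorem insertionHigher_of_diluteInsertionBound
    (hE2 : open Literature.MathematicalPhysics.QuantumFieldTheory.Balaban1983to89 Literature.MathematicalPhysics.QuantumFieldTheory.Balaban1983to89.T3ContinuumYM3Torus in ∀ (L : ℕ), ∃ ε₀ : ℝ, 0 < ε₀ ∧ ∀ (ε : ℝ), 0 < ε → ε ≤ ε₀ → ∀ (b₀ p₀ : ℝ), 0 < b₀ → 2 < p₀ → ∃ M₀ : ℝ, 0 ≤ M₀ ∧ ∃ γ₁ : ℝ, 0 < γ₁ ∧ γ₁ ≤ 1 ∧ ∀ (F : T3Family) (γ : ℝ), F.L = L → 0 < γ → γ ≤ γ₁ → ∀ (K j : ℕ), 1 ≤ j → j ≤ K → 2 ≤ j → ∃ ρ : ℝ, 1 ≤ ρ ∧ ∀ (S : Finset (Plaq (F.P K) j)), (∀ q ∈ S, ∀ q' ∈ S, q ≠ q' → ρ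 ≤ (Site.tdist q.src q'.src : ℝ)) → ∫ U, Real.exp (ε * ∑ q ∈ S, min (GaugeGroup.dist1 (GaugeField.plaqHol (Averaging.iter (fun i' => BlockAveraging.blockAvg (P := F.P K) (j := i') T3UnitLawDensityEML.ℰp) j U) q) / Real.sqrt (γ * ((F.L : ℝ)⁻¹) ^ (K - j))) (B10.pFun b₀ p₀ (Real.sqrt (γ * ((F.L : ℝ)⁻¹) ^ (K - j))))) ∂(T3UnitScaleTilt.gibbsK F T3UnitLawDensityEML.ℰp γ K) ≤ M₀ ^ S.card) :
    open Literature.MathematicalPhysics.QuantumFieldTheory.Balaban1983to89 Literature.MathematicalPhysics.QuantumFieldTheory.Balaban1983to89.T3ContinuumYM3Torus in ∀ (L : ℕ), ∃ ε₀ : ℝ, 0 < ε₀ ∧ ∀ (ε : ℝ), 0 < ε → ε ≤ ε₀ → ∀ (b₀ p₀ : ℝ), 0 < b₀ → 2 < p₀ → ∃ M₀ : ℝ, 0 ≤ M₀ ∧ ∃ γ₁ : ℝ, 0 < γ₁ ∧ γ₁ ≤ 1 ∧ ∀ (F : T3Family) (γ : ℝ), F.L = L → 0 < γ → γ ≤ γ₁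 → ∀ (K j : ℕ), 1 ≤ j → j ≤ K → 2 ≤ j → ∀ (a : Plaq (F.P K) j), ∫ U in {U | (∀ (i : ℕ) (q : Plaq (F.P K) i), i < j → Site.tdist (fun k => ((((q.src k).val * F.L ^ i : ℕ)) : ZMod ((F.P K).sitesPerDir 0))) (fun k => ((((a.src k).val * F.L ^ j : ℕ)) : ZMod ((F.P K).sitesPerDir 0))) + 64 * F.L ^ i ≤ 64 * F.L ^ j → GaugeGroup.dist1 (GaugeField.plaqHol (Averaging.iter (fun i' => BlockAveraging.blockAvg (P := F.P K) (j := i') T3UnitLawDensityEML.ℰp) i U) q) < T3UnitScaleTilt.θBal F.L γ b₀ p₀ (K - i))}, Real.exp (ε * min (GaugeGroup.dist1 (GaugeField.plaqHol (Averaging.iter (fun i' => BlockAveraging.blockAvg (P := F.P K) (j := i') T3UnitLawDensityEML.ℰp) j U) a) / Real.sqrt (γ * ((F.L : ℝ)⁻¹) ^ (K - j))) (B10.pFun b₀ p₀ (Real.sqrt (γ * ((F.L : ℝ)⁻¹) ^ (K - j))))) ∂(T3UnitScaleTilt.gibbsK F T3UnitLawDensityEML.ℰp γ K) ≤ M₀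 :=
  localInsertion_of_diluteInsertionBound (fun _ j => 2 ≤ j) hE2

/-! ## §4 The pressure form: the dilute-family bound is a King-(2.23)-type bound on the dressed partition function -/

/-- **PRESSURE FORM.**  The periodised-insertion moment IS the ratio of DRESSED PARTITION FUNCTIONS of the T⁴ cell's node E2
(`T4GenFunBounds.dressedZ`, King's generating functional (2.9) with one source): `E_K[exp(ε·Σ_{q∈S} φ_q)] =
Z_K(ε; Σ_{q∈S} φ_q) ∕ Z_K(0)` — so the displayed hypothesis of §3 reads `log Z_K(ε; Σ_{q∈S} φ_q) − log Z_K(0) ≤ |S|·log M₀`,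
a ONE-SIDED UV-stability bound for the dressed partition function LINEAR IN THE NUMBER OF INSERTIONS — the format of
[King1986] Thm 2.1 (ii) `|ln Z(T, g, h)| ≤ C|T|` quoted in `T4GenFunBounds` (there `|T|` = volume; here `|S|` cells of side `L^s`).
[folklore] -/
theorem integral_exp_sum_eq_dressedZ_div (F : T3Family) {γ : ℝ} (hγ : 0 ≤ γ) (ε b₀ p₀ : ℝ) (K j : ℕ)
    (S : Finset (Plaq (F.P K) j)) :
    ∫ U, Real.exp (ε * ∑ q ∈ S, min (GaugeGroup.dist1 (GaugeField.plaqHol (Averaging.iter (fun i' => BlockAveraging.blockAvg (P := F.P K) (j := i') T3UnitLawDensityEML.ℰp) j U) q) / Real.sqrt (γ * ((F.L : ℝ)⁻¹) ^ (K - j))) (B10.pFun b₀ p₀ (Real.sqrt (γ * ((F.L : ℝ)⁻¹) ^ (K - j))))) ∂(T3UnitScaleTilt.gibbsK F T3UnitLawDensityEML.ℰp γ K) =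
      T4GenFunBounds.dressedZ (F.P K) ((F.scheme ℰp γ).β K) (fun U => ∑ q ∈ S, min (GaugeGroup.dist1 (GaugeField.plaqHol (Averaging.iter (fun i' => BlockAveraging.blockAvg (P := F.P K) (j := i') T3UnitLawDensityEML.ℰp) j U) q) / Real.sqrt (γ * ((F.L : ℝ)⁻¹) ^ (K - j))) (B10.pFun b₀ p₀ (Real.sqrt (γ * ((F.L : ℝ)⁻¹) ^ (K - j))))) ε /
        T4GenFunBounds.dressedZ (F.P K) ((F.scheme ℰp γ).β K) (fun U => ∑ q ∈ S, min (GaugeGroup.dist1 (GaugeField.plaqHol (Averaging.iter (fun i' => BlockAveraging.blockAvg (P := F.P K) (j := i') T3UnitLawDensityEML.ℰp) j U) q) / Real.sqrt (γ * ((F.L : ℝ)⁻¹) ^ (K - j))) (B10.pFun b₀ p₀ (Real.sqrt (γ * ((F.L : ℝ)⁻¹) ^ (K - j))))) 0 := by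
  rw [T4GenFunBounds.dressedZ_div_eq_mgf (F.P K) (F.scheme_β_nonneg ℰp hγ K), ProbabilityTheory.mgf, gibbsK_eq]

end

end Summit.QuantumFields.YangMills.Theorems.LocalInsertion.ChessboardInsertionT3
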